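import Summits.Ventures.HSemireg.WedgeHankelRecurrenceGaussChebyshevTFixedPointIdeal

/-!
# Venture HSemireg — **THE `−2`-LEVEL IDEAL: `(C_m + 2, C_n + 2) = (C_{gcd(m,n)} + 2)` IN `R[X]` FOR EVERY COMMUTATIVE RING, WHEN `m ∕ gcd` AND `n ∕ gcd` ARE BOTH ODD** (the points `x = t + t⁻¹` with
# `t^m = −1` against those with `t^n = −1`), hence **`gcd(V_m + 2, V_n + 2) = |V_{gcd} + 2|`** for `V_n(P, 1)` in that case — same faithfully flat quadratic extension as N489: there `C_k + 2 =
# t^{−k}(t^k + 1)²` and, for ODD `k ∕ g`, `t^k + 1 = −((−t^g)^{k∕g} − 1)`, so N489's `((y^{m'} − 1)², (y^{n'} − 1)²) = ((y − 1)²)` applies with `y = −t^g`.  (When one of `m ∕ g`, `n ∕ g` is even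
# the ideal is strictly smaller than `(C_g + 2)` in general — e.g. `(C_2 + 2, C_4 + 2) = (X², (X² − 2)²) = (1)` over `ℚ` — and is not typed here.)

HONEST FRAMING. Part of the Lean index of the computation cell `pub-hsemireg` (seat p10 gen 48, Sunday typer «UNIFORM-IN-n»).  Commutative algebra of polynomial ideals only; no variety, no cohomology
theory, no sheaf, no Ext group and no semiregularity map is constructed here; nothing here says that HC / HC_CM / HC_AV holds; no Literature fact (unproved `Prop`) is declared or used.  Custodian
versions as in `WedgeHankelSiegelIdeal` (1/3).
SOURCES (cited).  R. Lidl, G. L. Mullen, G. Turnwald, *Dickson Polynomials* (1993), Ch. 3; H. Matsumura, *Commutative Ring Theory* (1986), Thm 7.5; P. Ribenboim, *My Numbers, My Friends* (2000), Ch. 1 §IV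
((IV.28)-type laws).
PROOF TYPED HERE.  N489 `quadExt_monic_natDegree`, `quadExt_chebyshevC`, `span_pair_pow_sub_one_sq`; Mathlib `AdjoinRoot`, `Polynomial.Monic.free_adjoinRoot`, `Ideal.comap_map_eq_self_of_faithfullyFlat`,
`Odd.neg_pow`, `Ideal.span_singleton_mul_left_unit`, `Ideal.span_insert`; N476 `int_gcd_eq_natAbs_of_span_pair_eq`, `lucasV_one_eq_chebyshevC_eval`.
DEDUP DISCLOSURE (`rg -n 'quadExt_chebyshevC_add_two|neg_pow_sub_one_sq_eq|chebyshevC_add_two_span_pair|lucasV_one_add_two_gcd' Summits Literature HarnessLib`, 2026-09-04): `Literature…LucasSequences.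
Divisibility.gcd_V_V` ((IV.28), `gcd(V_m, V_n)`) — different statement; 0 hits for the 4 names below.

WHAT IS IN THE TREE.  N476, N489, N490.
THIS FILE (namespace `Summit.Ventures.HSemireg.Wedge.HankelOuter` continued; CHAINED on N490; 0 definitions):
* §1256 `quadExt_chebyshevC_add_two` (`C_k + 2 ↦ σ^k (τ^k + 1)²`), `neg_pow_sub_one_sq_eq` (odd exponent), **`chebyshevC_add_two_span_pair`**, **`lucasV_one_add_two_gcd`**.
CAVEATS.  Odd ∕ odd case only (see above).  Nothing Ext-side.  New names only.
-/

open Module Polynomial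
open scoped Matrix Polynomial

namespace Summit.Ventures.HSemireg.Wedge.HankelOuter

/-! ## §1256. `(C_m + 2, C_n + 2) = (C_g + 2)` for `m ∕ g`, `n ∕ g` odd -/

/-- In an `R[X]`-algebra with `τ σ = 1`, `τ + σ = X`: **`C_k(X) + 2 = σ^k (τ^k + 1)²`**. [this file, §1256] -/
theorem quadExt_chebyshevC_add_two {R B : Type*} [CommRing R] [CommRing B] [Algebra R[X] B] {τ σ : B} (hmul : τ * σ = 1) (hadd : τ + σ = algebraMap R[X] B Polynomial.X) (k : ℕ) :
    algebraMap R[X] B (Polynomial.Chebyshev.C R (k : ℤ) + 2) = σ ^ k * (τ ^ k + 1) ^ 2 := by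
  rw [map_add, quadExt_chebyshevC hmul hadd k, map_ofNat]
  have h2 : τ ^ k * σ ^ k = 1 := by rw [← mul_pow, hmul, one_pow]
  linear_combination (-(τ ^ k) - 2) * h2

/-- For odd `k`: `((−y)^k − 1)² = (y^k + 1)²`. [bookkeeping; this file, §1256] -/
theorem neg_pow_sub_one_sq_eq {B : Type*} [CommRing B] (y : B) {k : ℕ} (hk : Odd k) : ((-y) ^ k - 1) ^ 2 = (y ^ k + 1) ^ 2 := by
  rw [hk.neg_pow]; ring

/-- **`(C_m + 2, C_n + 2) = (C_{gcd(m,n)} + 2)` in `R[X]` for every commutative ring `R`, provided `m ∕ gcd(m,n)` and `n ∕ gcd(m,n)` are both odd.** [Lidl–Mullen–Turnwald Ch. 3; Matsumura Thm 7.5;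
this file, §1256] -/
theorem chebyshevC_add_two_span_pair {R : Type*} [CommRing R] {m n : ℕ} (hm : Odd (m / Nat.gcd m n)) (hn : Odd (n / Nat.gcd m n)) :
    Ideal.span {Polynomial.Chebyshev.C R (m : ℤ) + 2, Polynomial.Chebyshev.C R (n : ℤ) + 2} = Ideal.span {Polynomial.Chebyshev.C R (Nat.gcd m n : ℤ) + 2} := by
  rcases subsingleton_or_nontrivial R with hR | hR
  · haveI : Subsingleton (Ideal R[X]) := (Submodule.subsingleton_iff R[X]).2 inferInstance
    exact Subsingleton.elim _ _
  -- arithmetic of the indices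
  obtain ⟨g, hgdef⟩ : ∃ g, Nat.gcd m n = g := ⟨_, rfl⟩
  rw [hgdef] at hm hn ⊢
  have hg : 0 < g := by
    rcases Nat.eq_zero_or_pos g with h0 | h0
    · rw [h0, Nat.div_zero] at hm; exact absurd hm (by decide)
    · exact h0
  obtain ⟨m', hm'⟩ : g ∣ m := hgdef ▸ Nat.gcd_dvd_left m n
  obtain ⟨n', hn'⟩ : g ∣ n := hgdef ▸ Nat.gcd_dvd_right m n
  have hc := Nat.coprime_div_gcd_div_gcd (hgdef.symm ▸ hg)
  rw [hgdef] at hc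
  subst hm' hn'
  rw [Nat.mul_div_cancel_left _ hg] at hm hn hc
  rw [Nat.mul_div_cancel_left _ hg] at hc
  -- the quadratic extension `B = R[X][t] / (t² − X t + 1)`
  obtain ⟨hf, hf2⟩ := quadExt_monic_natDegree (Polynomial.X : R[X])
  set f : R[X][X] := Polynomial.X ^ 2 - (Polynomial.C (Polynomial.X : R[X]) * Polynomial.X - 1) with hf_def
  haveI : Module.Free R[X] (AdjoinRoot f) := hf.free_adjoinRoot
  haveI : Nontrivial (AdjoinRoot f) :=
    nontrivial_of_ne _ _ ((AdjoinRoot.powerBasis' hf).basis.ne_zero ⟨0, by rw [AdjoinRoot.powerBasis'_dim, hf2]; norm_num⟩)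
  have hroot := AdjoinRoot.eval₂_root f
  rw [← AdjoinRoot.algebraMap_eq, hf_def, eval₂_sub, eval₂_sub, eval₂_pow, eval₂_X, eval₂_mul, eval₂_C, eval₂_X, eval₂_one] at hroot
  have hmul : AdjoinRoot.root f * (algebraMap R[X] (AdjoinRoot f) Polynomial.X - AdjoinRoot.root f) = 1 := by
    linear_combination (-1 : AdjoinRoot f) * hroot
  have hadd : AdjoinRoot.root f + (algebraMap R[X] (AdjoinRoot f) Polynomial.X - AdjoinRoot.root f) = algebraMap R[X] (AdjoinRoot f) Polynomial.X := by ring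
  have hσ : IsUnit (algebraMap R[X] (AdjoinRoot f) Polynomial.X - AdjoinRoot.root f) := IsUnit.of_mul_eq_one (AdjoinRoot.root f) (by rw [mul_comm]; exact hmul)
  -- in `B`: `((τ^{g m'} + 1)², (τ^{g n'} + 1)²) = ((τ^g + 1)²)` via `y = −τ^g`
  have hsq : Ideal.span {(AdjoinRoot.root f ^ (g * m') + 1) ^ 2, (AdjoinRoot.root f ^ (g * n') + 1) ^ 2} = Ideal.span {((AdjoinRoot.root f ^ g + 1) ^ 2 : AdjoinRoot f)} := by
    have h := span_pair_pow_sub_one_sq (-(AdjoinRoot.root f ^ g)) m' n'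
    rwa [hc.gcd_eq_one, pow_one, neg_pow_sub_one_sq_eq _ hm, neg_pow_sub_one_sq_eq _ hn, show (-(AdjoinRoot.root f ^ g) - 1) ^ 2 = (AdjoinRoot.root f ^ g + 1) ^ 2 by ring, ← pow_mul,
      ← pow_mul] at h
  have key : Ideal.map (algebraMap R[X] (AdjoinRoot f)) (Ideal.span {Polynomial.Chebyshev.C R ((g * m' : ℕ) : ℤ) + 2, Polynomial.Chebyshev.C R ((g * n' : ℕ) : ℤ) + 2}) =
      Ideal.map (algebraMap R[X] (AdjoinRoot f)) (Ideal.span {Polynomial.Chebyshev.C R (g : ℤ) + 2}) := by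
    rw [Ideal.map_span, Ideal.map_span, Set.image_pair, Set.image_singleton, quadExt_chebyshevC_add_two hmul hadd, quadExt_chebyshevC_add_two hmul hadd,
      quadExt_chebyshevC_add_two hmul hadd, Ideal.span_insert, Ideal.span_singleton_mul_left_unit (hσ.pow _), Ideal.span_singleton_mul_left_unit (hσ.pow _),
      Ideal.span_singleton_mul_left_unit (hσ.pow _), ← Ideal.span_insert, hsq]
  rw [← Ideal.comap_map_eq_self_of_faithfullyFlat (B := AdjoinRoot f) (Ideal.span {Polynomial.Chebyshev.C R ((g * m' : ℕ) : ℤ) + 2, Polynomial.Chebyshev.C R ((g * n' : ℕ) : ℤ) + 2}), key,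
    Ideal.comap_map_eq_self_of_faithfullyFlat]

/-- **`gcd(V_m + 2, V_n + 2) = |V_{gcd(m,n)} + 2|`** for `V_0 = 2, V_1 = P, V_{k+2} = P V_{k+1} − V_k` over `ℤ`, when `m ∕ gcd`, `n ∕ gcd` are both odd. [this file, §1256] -/
theorem lucasV_one_add_two_gcd {P : ℤ} {V : ℕ → ℤ} (hV0 : V 0 = 2) (hV1 : V 1 = P) (hV : ∀ n, V (n + 2) = P * V (n + 1) - V n) {m n : ℕ} (hm : Odd (m / Nat.gcd m n))
    (hn : Odd (n / Nat.gcd m n)) : Int.gcd (V m + 2) (V n + 2) = (V (Nat.gcd m n) + 2).natAbs := by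
  have hev : ∀ k : ℕ, Polynomial.evalRingHom P (Polynomial.Chebyshev.C ℤ (k : ℤ) + 2) = V k + 2 := fun k => by
    rw [map_add, map_ofNat, Polynomial.coe_evalRingHom, lucasV_one_eq_chebyshevC_eval hV0 hV1 hV k]
  have h := congrArg (Ideal.map (Polynomial.evalRingHom P)) (chebyshevC_add_two_span_pair (R := ℤ) hm hn)
  rw [Ideal.map_span, Ideal.map_span, Set.image_pair, Set.image_singleton, hev, hev, hev] at h
  exact int_gcd_eq_natAbs_of_span_pair_eq h

end Summit.Ventures.HSemireg.Wedge.HankelOuter
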